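import Summits.Langlands.Langlands.Theses.NonParallelVoid
import Summits.Langlands.Langlands.Theorems.ResidueParallel.Negative.IrreducibleRedundant
import Summits.Langlands.Langlands.Theorems.ResidueParallel.Negative.IrreducibleOfResidual

/-!
# Disproof of `ResidueParallel` (crux stmt-Langlands-17003, route `NonParallelVoid`) — findings

cdisprove seat `refuter-cdisprove-stmt-Langlands-17003-0`, cycle 1 (2026-08-17).  Line under attack:
`inert-fl-transfer` (lead `prover-line-stmt-Langlands-17003-0`).  VERDICT SO FAR: **no kill**.  The crux
(`F` imaginary quadratic, `ρ : Γ_F → GL₂(ℚ̄_p)` irreducible, a.e. unramified, de Rham above `p` with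
two distinct labelled Hodge–Tate weights per label, NOT nearly ordinary at some `v ∣ p`, NOT in the good
regime `G` ⇒ the two gaps are equal) is a sub-case of the Calegari–Mazur parallel-weight prediction,
itself a consequence of Fontaine–Mazur + Langlands reciprocity + Clozel purity; a refutation would be a
counterexample to Fontaine–Mazur over an imaginary quadratic field.  None is known or in print
(Calegari 2010 = arXiv:0907.3427 Thm 1.4; Childers arXiv:2001.04956 §1.5 records the question as open).

## Index of findings

* **(F0) Faithfulness / no junk handle.**  The statement elaborates (rc 0); read-back agrees with the
  informal text.  `labelledHodgeTateWeightsAt` is computed relative to the CONSTRUCTED `B_dR(F_v)`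
  (`fontainePstAdicCompletion_𝔅_eq_bdRPeriodRingData`, unconditional) and the canonical `ℚ_p`-structure
  (`fontainePstAdicCompletion_algebra_eq_adicCompletionPadicAlgebra`; NB any ring map `ℚ_p → F_v` is
  automatically continuous — `ℤ_p = {x | 1 + p x² is a square}` for odd `p`, cubes for `p = 2` — so no
  exotic algebra structure exists); labels `(v, τ : F_v →ₐ[ℚ_p] ℚ̄_p)` are always exactly two (split:
  one at each of `v ≠ v̄`; inert/ramified: two at the unique `v`), so the conclusion has content
  "gap₁ = gap₂", `g` determined up to sign, `g = 0` excluded by `a < b`.  The only epsilon-pinned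
  predicate, `IsCrystallineFramed`, sits inside the NEGATED regime hypothesis `¬G`: junk there only moves
  the regime boundary (the crux stays below `Target` in strength).  No prover-chosen / ∃-bound data.
* **(F1) `hirr` is REDUNDANT** (kernel-checked, § LoadBearing): `¬ (∀ v ∣ p, HasInvariantCompleteFlag
  (ρ.toLocal v))` already forces `ρ` irreducible (a `Γ_F`-invariant line is `Γ_{F_v}`-invariant;
  rank-2 linear algebra) — `residueParallel_iff_withoutIrreducible`.  LANDED (canonical, imported
  here): `Theorems/ResidueParallel/Negative/IrreducibleRedundant.lean` (p168886 ACCEPTED @647b34c5b5c8: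
  `Negative.isIrreducible_of_not_forall_hasInvariantCompleteFlag`,
  `Negative.residueParallel_iff_without_isIrreducible`) and, for the regimes `G`/`U` (stubs 1–3 of the
  line), `Theorems/ResidueParallel/Negative/IrreducibleOfResidual.lean` (p169074 ACCEPTED @d8a5dd209c36:
  `Negative.isIrreducible_of_isResiduallyAbsIrreducible_cyclotomic`).  Consequence: no refutation can come from a reducible `ρ`; the only cheap
  non-parallel geometric representations over `F` — sums `χ₁ ⊕ χ₂` of algebraic Hecke characters of
  unequal gaps (∞-types `(0,0)`, `(1,2)`) — are excluded by `¬hLR`, not by `hirr`.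
* **(F2) `hDR` (de Rham at every `v ∣ p`) is informally REDUNDANT** given the second conjunct of `hHT`
  (`card HT_τ = 2` at EVERY label forces `D_dR(ρ|F_v ⊗ ℚ̄_p)` free of rank 2 over `F_v ⊗ ℚ̄_p`, i.e. de
  Rham).  Not attempted in Lean: `IsDeRhamFramed = ∃` finite `E`-model `B_dR`-admissible
  (`FramedRep.IsDeRhamWith`) and the bridge labelled-`ℚ̄_p`-dims ↔ `E`-model admissibility is not in the
  tree (needs `exists_hasQlModel` + base change of `D_dR`).  Information for provers only.
* **(F3) `hF : IsTotallyComplex F` is LOAD-BEARING** (informal witness, not constructible here): over a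
  REAL quadratic `F` every non-parallel-weight Hilbert newform `f` of weight `(k₁, k₂)`, `k₁ ≠ k₂`,
  `k_i ≥ 2`, `k₁ ≡ k₂ (2)`, gives `ρ_{f,p}|Γ_F` irreducible, a.e. unramified, crystalline at `v ∣ p ∤ N`
  with labelled gaps `k₁ − 1 ≠ k₂ − 1`; choosing `p ∈ {5, 7}` split in `F` and `f` non-ordinary at some
  `v ∣ p` with `k_i ≤ p` makes `ρ|Γ_{F_v}` irreducible (`¬hLR`) and `¬G` (`p < 11`).  See
  `residueParallel_false_without_totallyComplex` (sorried near-miss: no Galois representations attached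
  to Hilbert eigenforms with computed labelled weights are constructible in the tree).
* **(F4) `[Algebra.IsQuadraticExtension ℚ F]` is LOAD-BEARING** (informal): for a quartic CM field
  `F' = F⁺·K` (`F⁺` real quadratic, `K` imaginary quadratic) the base change `ρ_{f,p}|Γ_{F'}` of the
  representation of (F3) has FOUR labels with gaps `(k₁−1, k₁−1, k₂−1, k₂−1)` — not all equal — and
  satisfies every other hypothesis.  `residueParallel_false_without_quadratic` (sorried, same reason).
  Moral: "all gaps equal" is an imaginary-QUADRATIC phenomenon; over general CM `F` the true statement
  is Clozel purity `gap_τ = gap_{τ∘c}` only (route header: "General CM fields F … deliberately out").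
* **(F5) `hunr` (a.e. unramified) is PRESUMABLY load-bearing, status OPEN**: Fontaine–Mazur needs finite
  ramification (Ramakrishna, Ann. of Math. 151 (2000), arXiv:math/0003241: infinitely ramified
  `ρ : G_ℚ → GL₂(ℤ_p)` potentially semistable at `p`); over an imaginary quadratic `F` with prescribed
  NON-parallel crystalline local conditions the infinitely-ramified lifting is not in print (defect
  `l₀ = 1` obstructs the known annihilation of dual Selmer).  Inductions of infinitely ramified
  characters do NOT help: a continuous `χ : Γ_K → ℚ̄_pˣ` lands in a finite `E/ℚ_p`, so `∏_q χ_q` is of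
  finite order on the global units and the Hodge–Tate type of `χ` obeys the same CM (Weil) constraint
  as an algebraic Hecke character ⇒ `Ind` stays parallel or irregular (cf. (D2)).  No Lean statement.
* **(F6) `a < b` (regularity) is NOT load-bearing for truth**: Clozel purity forces `gap_v = gap_{v̄}`
  also when a gap is `0`, so the strengthening `ResidueParallelIrregular` (`a ≤ b`) is conjecturally
  still true (`residueParallel_of_irregular` is the trivial direction).  `¬hLR`, `¬G` are load-bearing
  for the METHOD only (dropping them gives cruxes `LocallyReducibleParallel` / 2–4, conjecturally true).
* **(T1) Tightness**: the conclusion cannot be strengthened from "equal gaps" to "equal weight sets"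
  (`ResidueParallelSameWeights`): twisting `ρ_{E,p}|Γ_F` (`E/ℚ` non-CM elliptic curve supersingular at
  `p`, `p` split, e.g. `E = 14a1`, `F = ℚ(i)`, `p = 5`: the non-vacuity model of the vetting refuter) by
  the `p`-adic character of an algebraic Hecke character of `F` of ∞-type `(m, 0)`, `m ≠ 0`, shifts the
  weights at ONE label only: `{−1−m, −m}` vs `{−1, 0}` — equal gaps, different sets; all hypotheses kept
  (twist preserves irreducibility, local irreducibility at `v ∣ 5`, crystallinity for `m`-th power of a
  crystalline character).  `not_residueParallelSameWeights` (sorried: needs `ρ_{E,p}` / CM characters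
  with computed labelled weights, absent from the tree).
* **(D) Dead counterexample families (why it resists)**: (D1) reducible `χ₁ ⊕ χ₂` — killed by `¬hLR`
  (and (F1)); (D2) `Ind_K^F χ`, `K ⊋ F` quartic: `K` CM (biquadratic) ⇒ gaps `|n_{σ₁} − n_{σ₂}|` at both
  labels, PARALLEL; `K` non-CM ⇒ ∞-type through `N_{K/F}` ⇒ `HT_τ = {a, a}`, violates `a < b`;
  (D3) restrictions `ρ_f|Γ_F` of classical forms and their Hecke twists — parallel by construction;
  (D4) `p`-adic families through non-parallel weights (Calegari–Mazur arXiv:0708.2451, Barrera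
  Salazar–Williams arXiv:1808.09750, Childers arXiv:2001.04956): non-classical points are not known to
  be de Rham — an algebraic non-parallel point IS the open question; (D5) finite/decidable shadows: none
  (every object is infinite; no `decide`/`kit` reduction exists).
* **(L) Line `inert-fl-transfer`** (§ Line): all four stubs are conjecturally true (each is a sub-case of
  `Target`); the composition `ResidueParallel_of` is kernel-checked, so the stubs are JOINTLY SUFFICIENT
  with no smuggled gap.  Remarks for the lead: (L1) `hirr` is redundant in all four stubs (stubs 3–4
  carry `¬hLR`: (F1); stubs 1–2 carry `IsResiduallyAbsIrreducible (ρ.restrictField (CyclotomicField p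
  F))` inside `U`, which forces irreducibility of `ρ|Γ_{F(ζ_p)}` hence of `ρ` — cf.
  `Theorems/DyadicDihedralFM/Negative/IrreducibleRedundant.lean`); (L2) stubs 1–2 do not take `¬hLR` /
  `¬G` although both are in scope at their call sites in `ResidueParallel_of` — as typed they re-prove
  the split Fontaine–Laffaille-window part of cruxes 3/4 (harmless, but a prover may assume `¬G`, i.e.
  `p` INERT given `U`, for free by restating); (L3) no stub is refutable short of a Fontaine–Mazur
  counterexample; `stub_deepResidue` = the crux minus `U`, same status as the crux.

## What a kill would need
An explicit irreducible geometric `ρ : Γ_F → GL₂(ℚ̄_p)`, `F` imaginary quadratic, with regular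
NON-parallel labelled weights — i.e. a counterexample to Fontaine–Mazur (it cannot be automorphic by
Harder / Borel–Wallach + Clozel purity).  Not a finite computation; no certificate format exists.
-/

noncomputable section

set_option linter.dupNamespace false

namespace Summit.Langlands.Langlands.Cruxes.ResidueParallel.Disproof

open Literature.NumberTheory.GaloisRepresentations
open scoped MatrixGroups Matrix

/-! ## LoadBearing — (a) the crux with one hypothesis dropped / weakened -/

/-- `ResidueParallel` with the binder `ρ.toGaloisRep.IsIrreducible →` DELETED (everything else verbatim).
EQUIVALENT to the crux: `residueParallel_iff_withoutIrreducible` (finding (F1)). -/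
def ResidueParallelWithoutIrreducible : Prop :=
  ∀ (F : Type) [Field F] [NumberField F] [Algebra.IsQuadraticExtension ℚ F],
  NumberField.IsTotallyComplex F → ∀ (p : ℕ) [Fact p.Prime] (ρ :
  Literature.NumberTheory.GaloisRepresentations.FramedGaloisRep F (PadicAlgCl p) 2), (∀ᶠ v :
  IsDedekindDomain.HeightOneSpectrum (NumberField.RingOfIntegers F) in Filter.cofinite,
  ρ.IsUnramifiedAt v) → (∀ (v : IsDedekindDomain.HeightOneSpectrum (NumberField.RingOfIntegers F))
  (hv : ((p : ℕ) : NumberField.RingOfIntegers F) ∈ v.asIdeal),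
  (Literature.NumberTheory.PAdicHodge.fontainePstAdicCompletion v p hv).IsDeRhamFramed (ρ.toLocal
  v) ∧ (letI := (Literature.NumberTheory.PAdicHodge.fontainePstAdicCompletion v p hv).algebra; ∀ τ
  : v.adicCompletion F →ₐ[ℚ_[p]] PadicAlgCl p, ∃ a b : ℤ, a < b ∧ ρ.labelledHodgeTateWeightsAt v
  (Literature.NumberTheory.PAdicHodge.fontainePstAdicCompletion v p hv).algebra
  (Literature.NumberTheory.PAdicHodge.fontainePstAdicCompletion v p hv).𝔅 τ.toRingHom = {a, b})) →
  ¬ (∀ v : IsDedekindDomain.HeightOneSpectrum (NumberField.RingOfIntegers F), ((p : ℕ) :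
  NumberField.RingOfIntegers F) ∈ v.asIdeal →
  Literature.NumberTheory.GaloisRepresentations.FramedRep.HasInvariantCompleteFlag (ρ.toLocal v)) →
  ¬ (11 ≤ p ∧ (∃ v w : IsDedekindDomain.HeightOneSpectrum (NumberField.RingOfIntegers F), v ≠ w ∧
  ((p : ℕ) : NumberField.RingOfIntegers F) ∈ v.asIdeal ∧ ((p : ℕ) : NumberField.RingOfIntegers F) ∈
  w.asIdeal) ∧ (∀ (v : IsDedekindDomain.HeightOneSpectrum (NumberField.RingOfIntegers F)) (hv : ((p
  : ℕ) : NumberField.RingOfIntegers F) ∈ v.asIdeal),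
  (Literature.NumberTheory.PAdicHodge.fontainePstAdicCompletion v p hv).IsCrystallineFramed
  (ρ.toLocal v)) ∧
  Literature.NumberTheory.GaloisRepresentations.FramedGaloisRep.IsResiduallyAbsIrreducible
  (ρ.restrictField (CyclotomicField p F))) → ∃ g : ℤ, ∀ (v : IsDedekindDomain.HeightOneSpectrum
  (NumberField.RingOfIntegers F)) (hv : ((p : ℕ) : NumberField.RingOfIntegers F) ∈ v.asIdeal), letI
  := (Literature.NumberTheory.PAdicHodge.fontainePstAdicCompletion v p hv).algebra; ∀ τ :
  v.adicCompletion F →ₐ[ℚ_[p]] PadicAlgCl p, ∃ a : ℤ, ρ.labelledHodgeTateWeightsAt v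
  (Literature.NumberTheory.PAdicHodge.fontainePstAdicCompletion v p hv).algebra
  (Literature.NumberTheory.PAdicHodge.fontainePstAdicCompletion v p hv).𝔅 τ.toRingHom = {a, a + g}

/-- `ResidueParallel` with `NumberField.IsTotallyComplex F →` DELETED (so `F` may be REAL quadratic).
Informally FALSE (finding (F3): non-parallel Hilbert newforms); see
`residueParallel_false_without_totallyComplex`. -/
def ResidueParallelWithoutTotallyComplex : Prop :=
  ∀ (F : Type) [Field F] [NumberField F] [Algebra.IsQuadraticExtension ℚ F], ∀ (p : ℕ) [Fact
  p.Prime] (ρ : Literature.NumberTheory.GaloisRepresentations.FramedGaloisRep F (PadicAlgCl p) 2),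
  ρ.toGaloisRep.IsIrreducible → (∀ᶠ v : IsDedekindDomain.HeightOneSpectrum
  (NumberField.RingOfIntegers F) in Filter.cofinite, ρ.IsUnramifiedAt v) → (∀ (v :
  IsDedekindDomain.HeightOneSpectrum (NumberField.RingOfIntegers F)) (hv : ((p : ℕ) :
  NumberField.RingOfIntegers F) ∈ v.asIdeal),
  (Literature.NumberTheory.PAdicHodge.fontainePstAdicCompletion v p hv).IsDeRhamFramed (ρ.toLocal
  v) ∧ (letI := (Literature.NumberTheory.PAdicHodge.fontainePstAdicCompletion v p hv).algebra; ∀ τ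
  : v.adicCompletion F →ₐ[ℚ_[p]] PadicAlgCl p, ∃ a b : ℤ, a < b ∧ ρ.labelledHodgeTateWeightsAt v
  (Literature.NumberTheory.PAdicHodge.fontainePstAdicCompletion v p hv).algebra
  (Literature.NumberTheory.PAdicHodge.fontainePstAdicCompletion v p hv).𝔅 τ.toRingHom = {a, b})) →
  ¬ (∀ v : IsDedekindDomain.HeightOneSpectrum (NumberField.RingOfIntegers F), ((p : ℕ) :
  NumberField.RingOfIntegers F) ∈ v.asIdeal →
  Literature.NumberTheory.GaloisRepresentations.FramedRep.HasInvariantCompleteFlag (ρ.toLocal v)) →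
  ¬ (11 ≤ p ∧ (∃ v w : IsDedekindDomain.HeightOneSpectrum (NumberField.RingOfIntegers F), v ≠ w ∧
  ((p : ℕ) : NumberField.RingOfIntegers F) ∈ v.asIdeal ∧ ((p : ℕ) : NumberField.RingOfIntegers F) ∈
  w.asIdeal) ∧ (∀ (v : IsDedekindDomain.HeightOneSpectrum (NumberField.RingOfIntegers F)) (hv : ((p
  : ℕ) : NumberField.RingOfIntegers F) ∈ v.asIdeal),
  (Literature.NumberTheory.PAdicHodge.fontainePstAdicCompletion v p hv).IsCrystallineFramed
  (ρ.toLocal v)) ∧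
  Literature.NumberTheory.GaloisRepresentations.FramedGaloisRep.IsResiduallyAbsIrreducible
  (ρ.restrictField (CyclotomicField p F))) → ∃ g : ℤ, ∀ (v : IsDedekindDomain.HeightOneSpectrum
  (NumberField.RingOfIntegers F)) (hv : ((p : ℕ) : NumberField.RingOfIntegers F) ∈ v.asIdeal), letI
  := (Literature.NumberTheory.PAdicHodge.fontainePstAdicCompletion v p hv).algebra; ∀ τ :
  v.adicCompletion F →ₐ[ℚ_[p]] PadicAlgCl p, ∃ a : ℤ, ρ.labelledHodgeTateWeightsAt v
  (Literature.NumberTheory.PAdicHodge.fontainePstAdicCompletion v p hv).algebra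
  (Literature.NumberTheory.PAdicHodge.fontainePstAdicCompletion v p hv).𝔅 τ.toRingHom = {a, a + g}

/-- `ResidueParallel` with `[Algebra.IsQuadraticExtension ℚ F]` DELETED (so `F` may be any totally complex
field, e.g. quartic CM).  Informally FALSE (finding (F4): base change of (F3) to `F⁺·K`); see
`residueParallel_false_without_quadratic`. -/
def ResidueParallelWithoutQuadratic : Prop :=
  ∀ (F : Type) [Field F] [NumberField F], NumberField.IsTotallyComplex F → ∀ (p : ℕ) [Fact p.Prime]
  (ρ : Literature.NumberTheory.GaloisRepresentations.FramedGaloisRep F (PadicAlgCl p) 2),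
  ρ.toGaloisRep.IsIrreducible → (∀ᶠ v : IsDedekindDomain.HeightOneSpectrum
  (NumberField.RingOfIntegers F) in Filter.cofinite, ρ.IsUnramifiedAt v) → (∀ (v :
  IsDedekindDomain.HeightOneSpectrum (NumberField.RingOfIntegers F)) (hv : ((p : ℕ) :
  NumberField.RingOfIntegers F) ∈ v.asIdeal),
  (Literature.NumberTheory.PAdicHodge.fontainePstAdicCompletion v p hv).IsDeRhamFramed (ρ.toLocal
  v) ∧ (letI := (Literature.NumberTheory.PAdicHodge.fontainePstAdicCompletion v p hv).algebra; ∀ τ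
  : v.adicCompletion F →ₐ[ℚ_[p]] PadicAlgCl p, ∃ a b : ℤ, a < b ∧ ρ.labelledHodgeTateWeightsAt v
  (Literature.NumberTheory.PAdicHodge.fontainePstAdicCompletion v p hv).algebra
  (Literature.NumberTheory.PAdicHodge.fontainePstAdicCompletion v p hv).𝔅 τ.toRingHom = {a, b})) →
  ¬ (∀ v : IsDedekindDomain.HeightOneSpectrum (NumberField.RingOfIntegers F), ((p : ℕ) :
  NumberField.RingOfIntegers F) ∈ v.asIdeal →
  Literature.NumberTheory.GaloisRepresentations.FramedRep.HasInvariantCompleteFlag (ρ.toLocal v)) →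
  ¬ (11 ≤ p ∧ (∃ v w : IsDedekindDomain.HeightOneSpectrum (NumberField.RingOfIntegers F), v ≠ w ∧
  ((p : ℕ) : NumberField.RingOfIntegers F) ∈ v.asIdeal ∧ ((p : ℕ) : NumberField.RingOfIntegers F) ∈
  w.asIdeal) ∧ (∀ (v : IsDedekindDomain.HeightOneSpectrum (NumberField.RingOfIntegers F)) (hv : ((p
  : ℕ) : NumberField.RingOfIntegers F) ∈ v.asIdeal),
  (Literature.NumberTheory.PAdicHodge.fontainePstAdicCompletion v p hv).IsCrystallineFramed
  (ρ.toLocal v)) ∧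
  Literature.NumberTheory.GaloisRepresentations.FramedGaloisRep.IsResiduallyAbsIrreducible
  (ρ.restrictField (CyclotomicField p F))) → ∃ g : ℤ, ∀ (v : IsDedekindDomain.HeightOneSpectrum
  (NumberField.RingOfIntegers F)) (hv : ((p : ℕ) : NumberField.RingOfIntegers F) ∈ v.asIdeal), letI
  := (Literature.NumberTheory.PAdicHodge.fontainePstAdicCompletion v p hv).algebra; ∀ τ :
  v.adicCompletion F →ₐ[ℚ_[p]] PadicAlgCl p, ∃ a : ℤ, ρ.labelledHodgeTateWeightsAt v
  (Literature.NumberTheory.PAdicHodge.fontainePstAdicCompletion v p hv).algebra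
  (Literature.NumberTheory.PAdicHodge.fontainePstAdicCompletion v p hv).𝔅 τ.toRingHom = {a, a + g}

/-- `ResidueParallel` with the a.e.-unramified hypothesis DELETED.  Status OPEN, presumably false
(finding (F5): Fontaine–Mazur needs finite ramification — Ramakrishna 2000 over `ℚ`; the imaginary
quadratic non-parallel analogue of his construction is not in print).  No theorem is claimed. -/
def ResidueParallelWithoutAEUnramified : Prop :=
  ∀ (F : Type) [Field F] [NumberField F] [Algebra.IsQuadraticExtension ℚ F],
  NumberField.IsTotallyComplex F → ∀ (p : ℕ) [Fact p.Prime] (ρ :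
  Literature.NumberTheory.GaloisRepresentations.FramedGaloisRep F (PadicAlgCl p) 2),
  ρ.toGaloisRep.IsIrreducible → (∀ (v : IsDedekindDomain.HeightOneSpectrum
  (NumberField.RingOfIntegers F)) (hv : ((p : ℕ) : NumberField.RingOfIntegers F) ∈ v.asIdeal),
  (Literature.NumberTheory.PAdicHodge.fontainePstAdicCompletion v p hv).IsDeRhamFramed (ρ.toLocal
  v) ∧ (letI := (Literature.NumberTheory.PAdicHodge.fontainePstAdicCompletion v p hv).algebra; ∀ τ
  : v.adicCompletion F →ₐ[ℚ_[p]] PadicAlgCl p, ∃ a b : ℤ, a < b ∧ ρ.labelledHodgeTateWeightsAt v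
  (Literature.NumberTheory.PAdicHodge.fontainePstAdicCompletion v p hv).algebra
  (Literature.NumberTheory.PAdicHodge.fontainePstAdicCompletion v p hv).𝔅 τ.toRingHom = {a, b})) →
  ¬ (∀ v : IsDedekindDomain.HeightOneSpectrum (NumberField.RingOfIntegers F), ((p : ℕ) :
  NumberField.RingOfIntegers F) ∈ v.asIdeal →
  Literature.NumberTheory.GaloisRepresentations.FramedRep.HasInvariantCompleteFlag (ρ.toLocal v)) →
  ¬ (11 ≤ p ∧ (∃ v w : IsDedekindDomain.HeightOneSpectrum (NumberField.RingOfIntegers F), v ≠ w ∧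
  ((p : ℕ) : NumberField.RingOfIntegers F) ∈ v.asIdeal ∧ ((p : ℕ) : NumberField.RingOfIntegers F) ∈
  w.asIdeal) ∧ (∀ (v : IsDedekindDomain.HeightOneSpectrum (NumberField.RingOfIntegers F)) (hv : ((p
  : ℕ) : NumberField.RingOfIntegers F) ∈ v.asIdeal),
  (Literature.NumberTheory.PAdicHodge.fontainePstAdicCompletion v p hv).IsCrystallineFramed
  (ρ.toLocal v)) ∧
  Literature.NumberTheory.GaloisRepresentations.FramedGaloisRep.IsResiduallyAbsIrreducible
  (ρ.restrictField (CyclotomicField p F))) → ∃ g : ℤ, ∀ (v : IsDedekindDomain.HeightOneSpectrum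
  (NumberField.RingOfIntegers F)) (hv : ((p : ℕ) : NumberField.RingOfIntegers F) ∈ v.asIdeal), letI
  := (Literature.NumberTheory.PAdicHodge.fontainePstAdicCompletion v p hv).algebra; ∀ τ :
  v.adicCompletion F →ₐ[ℚ_[p]] PadicAlgCl p, ∃ a : ℤ, ρ.labelledHodgeTateWeightsAt v
  (Literature.NumberTheory.PAdicHodge.fontainePstAdicCompletion v p hv).algebra
  (Literature.NumberTheory.PAdicHodge.fontainePstAdicCompletion v p hv).𝔅 τ.toRingHom = {a, a + g}

/-- `ResidueParallel` with `IsDeRhamFramed (ρ.toLocal v) ∧` DELETED from `hHT`.  Informally EQUIVALENT to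
the crux (finding (F2): two labelled weights at every label force de Rham); only the trivial direction
`residueParallelWithoutDeRham_imp` is recorded, the converse needs the `E`-model bridge. -/
def ResidueParallelWithoutDeRham : Prop :=
  ∀ (F : Type) [Field F] [NumberField F] [Algebra.IsQuadraticExtension ℚ F],
  NumberField.IsTotallyComplex F → ∀ (p : ℕ) [Fact p.Prime] (ρ :
  Literature.NumberTheory.GaloisRepresentations.FramedGaloisRep F (PadicAlgCl p) 2),
  ρ.toGaloisRep.IsIrreducible → (∀ᶠ v : IsDedekindDomain.HeightOneSpectrum
  (NumberField.RingOfIntegers F) in Filter.cofinite, ρ.IsUnramifiedAt v) → (∀ (v :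
  IsDedekindDomain.HeightOneSpectrum (NumberField.RingOfIntegers F)) (hv : ((p : ℕ) :
  NumberField.RingOfIntegers F) ∈ v.asIdeal), (letI :=
  (Literature.NumberTheory.PAdicHodge.fontainePstAdicCompletion v p hv).algebra; ∀ τ :
  v.adicCompletion F →ₐ[ℚ_[p]] PadicAlgCl p, ∃ a b : ℤ, a < b ∧ ρ.labelledHodgeTateWeightsAt v
  (Literature.NumberTheory.PAdicHodge.fontainePstAdicCompletion v p hv).algebra
  (Literature.NumberTheory.PAdicHodge.fontainePstAdicCompletion v p hv).𝔅 τ.toRingHom = {a, b})) →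
  ¬ (∀ v : IsDedekindDomain.HeightOneSpectrum (NumberField.RingOfIntegers F), ((p : ℕ) :
  NumberField.RingOfIntegers F) ∈ v.asIdeal →
  Literature.NumberTheory.GaloisRepresentations.FramedRep.HasInvariantCompleteFlag (ρ.toLocal v)) →
  ¬ (11 ≤ p ∧ (∃ v w : IsDedekindDomain.HeightOneSpectrum (NumberField.RingOfIntegers F), v ≠ w ∧
  ((p : ℕ) : NumberField.RingOfIntegers F) ∈ v.asIdeal ∧ ((p : ℕ) : NumberField.RingOfIntegers F) ∈
  w.asIdeal) ∧ (∀ (v : IsDedekindDomain.HeightOneSpectrum (NumberField.RingOfIntegers F)) (hv : ((p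
  : ℕ) : NumberField.RingOfIntegers F) ∈ v.asIdeal),
  (Literature.NumberTheory.PAdicHodge.fontainePstAdicCompletion v p hv).IsCrystallineFramed
  (ρ.toLocal v)) ∧
  Literature.NumberTheory.GaloisRepresentations.FramedGaloisRep.IsResiduallyAbsIrreducible
  (ρ.restrictField (CyclotomicField p F))) → ∃ g : ℤ, ∀ (v : IsDedekindDomain.HeightOneSpectrum
  (NumberField.RingOfIntegers F)) (hv : ((p : ℕ) : NumberField.RingOfIntegers F) ∈ v.asIdeal), letI
  := (Literature.NumberTheory.PAdicHodge.fontainePstAdicCompletion v p hv).algebra; ∀ τ :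
  v.adicCompletion F →ₐ[ℚ_[p]] PadicAlgCl p, ∃ a : ℤ, ρ.labelledHodgeTateWeightsAt v
  (Literature.NumberTheory.PAdicHodge.fontainePstAdicCompletion v p hv).algebra
  (Literature.NumberTheory.PAdicHodge.fontainePstAdicCompletion v p hv).𝔅 τ.toRingHom = {a, a + g}

/-- STRENGTHENING: `a < b` weakened to `a ≤ b` in `hHT` (irregular weights allowed).  Conjecturally still
TRUE (finding (F6): Clozel purity gives `gap_v = gap_{v̄}` also for gap `0`); `residueParallel_of_irregular`
is the trivial direction.  Not a refutation handle. -/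
def ResidueParallelIrregular : Prop :=
  ∀ (F : Type) [Field F] [NumberField F] [Algebra.IsQuadraticExtension ℚ F],
  NumberField.IsTotallyComplex F → ∀ (p : ℕ) [Fact p.Prime] (ρ :
  Literature.NumberTheory.GaloisRepresentations.FramedGaloisRep F (PadicAlgCl p) 2),
  ρ.toGaloisRep.IsIrreducible → (∀ᶠ v : IsDedekindDomain.HeightOneSpectrum
  (NumberField.RingOfIntegers F) in Filter.cofinite, ρ.IsUnramifiedAt v) → (∀ (v :
  IsDedekindDomain.HeightOneSpectrum (NumberField.RingOfIntegers F)) (hv : ((p : ℕ) :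
  NumberField.RingOfIntegers F) ∈ v.asIdeal),
  (Literature.NumberTheory.PAdicHodge.fontainePstAdicCompletion v p hv).IsDeRhamFramed (ρ.toLocal
  v) ∧ (letI := (Literature.NumberTheory.PAdicHodge.fontainePstAdicCompletion v p hv).algebra; ∀ τ
  : v.adicCompletion F →ₐ[ℚ_[p]] PadicAlgCl p, ∃ a b : ℤ, a ≤ b ∧ ρ.labelledHodgeTateWeightsAt v
  (Literature.NumberTheory.PAdicHodge.fontainePstAdicCompletion v p hv).algebra
  (Literature.NumberTheory.PAdicHodge.fontainePstAdicCompletion v p hv).𝔅 τ.toRingHom = {a, b})) →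
  ¬ (∀ v : IsDedekindDomain.HeightOneSpectrum (NumberField.RingOfIntegers F), ((p : ℕ) :
  NumberField.RingOfIntegers F) ∈ v.asIdeal →
  Literature.NumberTheory.GaloisRepresentations.FramedRep.HasInvariantCompleteFlag (ρ.toLocal v)) →
  ¬ (11 ≤ p ∧ (∃ v w : IsDedekindDomain.HeightOneSpectrum (NumberField.RingOfIntegers F), v ≠ w ∧
  ((p : ℕ) : NumberField.RingOfIntegers F) ∈ v.asIdeal ∧ ((p : ℕ) : NumberField.RingOfIntegers F) ∈
  w.asIdeal) ∧ (∀ (v : IsDedekindDomain.HeightOneSpectrum (NumberField.RingOfIntegers F)) (hv : ((p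
  : ℕ) : NumberField.RingOfIntegers F) ∈ v.asIdeal),
  (Literature.NumberTheory.PAdicHodge.fontainePstAdicCompletion v p hv).IsCrystallineFramed
  (ρ.toLocal v)) ∧
  Literature.NumberTheory.GaloisRepresentations.FramedGaloisRep.IsResiduallyAbsIrreducible
  (ρ.restrictField (CyclotomicField p F))) → ∃ g : ℤ, ∀ (v : IsDedekindDomain.HeightOneSpectrum
  (NumberField.RingOfIntegers F)) (hv : ((p : ℕ) : NumberField.RingOfIntegers F) ∈ v.asIdeal), letI
  := (Literature.NumberTheory.PAdicHodge.fontainePstAdicCompletion v p hv).algebra; ∀ τ :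
  v.adicCompletion F →ₐ[ℚ_[p]] PadicAlgCl p, ∃ a : ℤ, ρ.labelledHodgeTateWeightsAt v
  (Literature.NumberTheory.PAdicHodge.fontainePstAdicCompletion v p hv).algebra
  (Literature.NumberTheory.PAdicHodge.fontainePstAdicCompletion v p hv).𝔅 τ.toRingHom = {a, a + g}

/-- STRENGTHENING of the conclusion: equal weight SETS `{a, a+g}` with `a` uniform in the label (`∃ a g, ∀ v τ`)
instead of equal gaps (`∃ g, ∀ v τ, ∃ a`).  Informally FALSE (finding (T1): Hecke twist of ∞-type
`(m,0)`); see `not_residueParallelSameWeights`.  Records that the crux's conclusion is tight. -/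
def ResidueParallelSameWeights : Prop :=
  ∀ (F : Type) [Field F] [NumberField F] [Algebra.IsQuadraticExtension ℚ F],
  NumberField.IsTotallyComplex F → ∀ (p : ℕ) [Fact p.Prime] (ρ :
  Literature.NumberTheory.GaloisRepresentations.FramedGaloisRep F (PadicAlgCl p) 2),
  ρ.toGaloisRep.IsIrreducible → (∀ᶠ v : IsDedekindDomain.HeightOneSpectrum
  (NumberField.RingOfIntegers F) in Filter.cofinite, ρ.IsUnramifiedAt v) → (∀ (v :
  IsDedekindDomain.HeightOneSpectrum (NumberField.RingOfIntegers F)) (hv : ((p : ℕ) :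
  NumberField.RingOfIntegers F) ∈ v.asIdeal),
  (Literature.NumberTheory.PAdicHodge.fontainePstAdicCompletion v p hv).IsDeRhamFramed (ρ.toLocal
  v) ∧ (letI := (Literature.NumberTheory.PAdicHodge.fontainePstAdicCompletion v p hv).algebra; ∀ τ
  : v.adicCompletion F →ₐ[ℚ_[p]] PadicAlgCl p, ∃ a b : ℤ, a < b ∧ ρ.labelledHodgeTateWeightsAt v
  (Literature.NumberTheory.PAdicHodge.fontainePstAdicCompletion v p hv).algebra
  (Literature.NumberTheory.PAdicHodge.fontainePstAdicCompletion v p hv).𝔅 τ.toRingHom = {a, b})) →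
  ¬ (∀ v : IsDedekindDomain.HeightOneSpectrum (NumberField.RingOfIntegers F), ((p : ℕ) :
  NumberField.RingOfIntegers F) ∈ v.asIdeal →
  Literature.NumberTheory.GaloisRepresentations.FramedRep.HasInvariantCompleteFlag (ρ.toLocal v)) →
  ¬ (11 ≤ p ∧ (∃ v w : IsDedekindDomain.HeightOneSpectrum (NumberField.RingOfIntegers F), v ≠ w ∧
  ((p : ℕ) : NumberField.RingOfIntegers F) ∈ v.asIdeal ∧ ((p : ℕ) : NumberField.RingOfIntegers F) ∈
  w.asIdeal) ∧ (∀ (v : IsDedekindDomain.HeightOneSpectrum (NumberField.RingOfIntegers F)) (hv : ((p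
  : ℕ) : NumberField.RingOfIntegers F) ∈ v.asIdeal),
  (Literature.NumberTheory.PAdicHodge.fontainePstAdicCompletion v p hv).IsCrystallineFramed
  (ρ.toLocal v)) ∧
  Literature.NumberTheory.GaloisRepresentations.FramedGaloisRep.IsResiduallyAbsIrreducible
  (ρ.restrictField (CyclotomicField p F))) → ∃ a g : ℤ, ∀ (v : IsDedekindDomain.HeightOneSpectrum
  (NumberField.RingOfIntegers F)) (hv : ((p : ℕ) : NumberField.RingOfIntegers F) ∈ v.asIdeal), letI
  := (Literature.NumberTheory.PAdicHodge.fontainePstAdicCompletion v p hv).algebra; ∀ τ :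
  v.adicCompletion F →ₐ[ℚ_[p]] PadicAlgCl p, ρ.labelledHodgeTateWeightsAt v
  (Literature.NumberTheory.PAdicHodge.fontainePstAdicCompletion v p hv).algebra
  (Literature.NumberTheory.PAdicHodge.fontainePstAdicCompletion v p hv).𝔅 τ.toRingHom = {a, a + g}

/-! ### (F1) `hirr` is redundant — kernel-checked in the LANDED files
`Theorems/ResidueParallel/Negative/IrreducibleRedundant.lean` (p168886) and
`Theorems/ResidueParallel/Negative/IrreducibleOfResidual.lean` (p169074), imported above. -/

/-- **(F1) `hirr` is redundant**: the crux is equivalent to `ResidueParallelWithoutIrreducible`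
(re-export of `Negative.residueParallel_iff_without_isIrreducible`). -/
theorem residueParallel_iff_withoutIrreducible :
    Summit.Langlands.Langlands.Theses.NonParallelVoid.ResidueParallel ↔
      ResidueParallelWithoutIrreducible :=
  Summit.Langlands.Langlands.Theorems.ResidueParallel.Negative.residueParallel_iff_without_isIrreducible

/-- **(F1′) for the line's regime `U` / the crux's regime `G`**: residual absolute irreducibility of
`ρ|Γ_{F(ζ_p)}` alone forces `hirr` (re-export of
`Negative.isIrreducible_of_isResiduallyAbsIrreducible_cyclotomic`; used by stubs 1–3 of `inert-fl-transfer`,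
which do not carry `¬hLR`). -/
theorem isIrreducible_of_regimeU {F : Type} [Field F] [NumberField F] {p : ℕ} [Fact p.Prime]
    (ρ : FramedGaloisRep F (PadicAlgCl p) 2)
    (h : FramedGaloisRep.IsResiduallyAbsIrreducible (ρ.restrictField (CyclotomicField p F))) :
    ρ.toGaloisRep.IsIrreducible :=
  Summit.Langlands.Langlands.Theorems.ResidueParallel.Negative.isIrreducible_of_isResiduallyAbsIrreducible_cyclotomic
    ρ h

/-! ### (F2) de Rham: only the trivial direction -/

/-- (F2) trivial direction: the crux without `hDR` implies the crux. -/
theorem residueParallelWithoutDeRham_imp :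
    ResidueParallelWithoutDeRham → Summit.Langlands.Langlands.Theses.NonParallelVoid.ResidueParallel := by
  intro h F _ _ _ hF p _ ρ hirr hunr hHT hLR hG
  exact h F hF p ρ hirr hunr (fun v hv => (hHT v hv).2) hLR hG

/-! ### (F3)–(F4) totally complex / quadratic: load-bearing (near-misses, informal witnesses) -/

/-- **(F3) near-miss.** `¬ ResidueParallelWithoutTotallyComplex`: witness = `ρ_{f,p}|Γ_F` for a
non-parallel-weight Hilbert newform `f` over a real quadratic `F` (`p ∈ {5,7}` split, `p ∤ N`, `f`
non-ordinary at some `v ∣ p`, `k_i ≤ p`): gaps `k₁ − 1 ≠ k₂ − 1`.  OBSTRUCTION: the tree has no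
construction of `ρ_{f,p}` (only interfaces `CuspidalAutomorphicRepData` / named facts), nor its
labelled weights; a proof would be "modulo `H` = existence of that representation with its local
data", which is the witness itself.  Tried: nothing cheaper exists (any witness is a geometric
irreducible regular `ρ`, hence conjecturally automorphic of non-parallel weight, which exists only over
fields with a real place). -/
theorem residueParallel_false_without_totallyComplex : ¬ ResidueParallelWithoutTotallyComplex := by
  sorry

/-- **(F4) near-miss.** `¬ ResidueParallelWithoutQuadratic`: witness = base change of (F3) to the quartic
CM field `F⁺·K`; four labels with gaps `(k₁−1, k₁−1, k₂−1, k₂−1)`.  Same obstruction as (F3). -/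
theorem residueParallel_false_without_quadratic : ¬ ResidueParallelWithoutQuadratic := by
  sorry

/-! ### (F6) irregular strengthening: trivial direction only -/

/-- (F6) the strengthening with `a ≤ b` implies the crux (conjecturally they are equivalent). -/
theorem residueParallel_of_irregular :
    ResidueParallelIrregular → Summit.Langlands.Langlands.Theses.NonParallelVoid.ResidueParallel := by
  intro h F _ _ _ hF p _ ρ hirr hunr hHT hLR hG
  refine h F hF p ρ hirr hunr (fun v hv => ⟨(hHT v hv).1, ?_⟩) hLR hG
  intro τ
  obtain ⟨a, b, hab, e⟩ := (hHT v hv).2 τ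
  exact ⟨a, b, hab.le, e⟩

/-! ## Tightness — (b) the conclusion cannot be strengthened to equal weight sets -/

/-- (T1) the same-weights strengthening implies the crux (trivial direction). -/
theorem residueParallel_of_sameWeights :
    ResidueParallelSameWeights → Summit.Langlands.Langlands.Theses.NonParallelVoid.ResidueParallel := by
  intro h F _ _ _ hF p _ ρ hirr hunr hHT hLR hG
  obtain ⟨a, g, hg⟩ := h F hF p ρ hirr hunr hHT hLR hG
  exact ⟨g, fun v hv τ => ⟨a, hg v hv τ⟩⟩

/-- **(T1) near-miss.** `¬ ResidueParallelSameWeights`: witness = `(ρ_{E,5}|Γ_{ℚ(i)}) ⊗ χ_m`, `E = 14a1`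
(supersingular at 5), `χ_m` the `5`-adic character of an algebraic Hecke character of `ℚ(i)` of ∞-type
`(m, 0)`, `m ≠ 0` (exists for `m ≡ 0 mod 4`): labelled weights `{−1−m, −m}` at `v` and `{−1, 0}` at
`v̄` — equal gaps, different sets.  OBSTRUCTION: neither `ρ_{E,p}` nor CM characters with computed
labelled weights at the pinned datum are constructible in the tree. -/
theorem not_residueParallelSameWeights : ¬ ResidueParallelSameWeights := by
  sorry

/-! ## Strengthenings — (c) finite-model refutations: none available
Every object in the crux is infinite (number fields, `Γ_F`, `ℚ̄_p`, `B_dR`); no decidable shadow exists,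
so no `decide` / `native_decide` / `kit compute` attack applies (recorded so that later seats do not retry). -/

/-! ## Targets — (d) the lead's stuck stubs: none filed this cycle (`stuck_stubs = []`). -/

/-! ## Line `inert-fl-transfer` — (L) stub-level remarks (no kill)
(L1) `hirr` redundant in all four stubs; (L2) stubs 1–2 omit `¬hLR`, `¬G` available at the call site
(they re-cover the split FL-window part of cruxes 3/4); (L3) joint sufficiency is the kernel-checked
`ResidueParallel_of`; `stub_deepResidue` has the status of the crux itself. -/

end Summit.Langlands.Langlands.Cruxes.ResidueParallel.Disproof

end
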